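import Summits.QuantumFields.BalabanUV.Beta.BorderedHessianKernel
import Summits.QuantumFields.BalabanUV.Beta.GAN24.TransverseDictionary

/-!
# Transposition symmetries of the packed kernels: the sign-conjugation gadget `sgnK`, `trK (bhK N) = sgnK (bhK N)`,
# the SYMMETRY OF THE MULTIPLIER RESPONSE `wΦ`, and `trK (KInv N) = sgnK (KInv N)` (β sub-cell, row BETA-an2, gen 13)

HONEST FRAMING (cell charter, verbatim): «discharging BetaPertH makes Balaban's UV stability UNCONDITIONAL — a real
constructive-QFT result; it is NOT the continuum limit and NOT the Clay problem.»  DERIVED cell leaf (pub-balaban β sub-cell, lane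
an2 gen 13); no statement of Bałaban's papers is typed here, no `[cite:]` tag, no `Prop` fact; it instantiates no binder of the
β-function wall by itself.  NOT `BetaPertH`; NOT continuum; NOT Clay.

## What is here

The bordered system `[[d*d, −𝒬ᵀ], [𝒬, 0]]` and its packed resolvent `KInv = [[Γ, ℋ], [ℋ♭, −𝒞]]` are not symmetric as kernels but
SIGN-CONJUGATE symmetric: transposition = conjugation by `S = diag(+1 on field legs, −1 on multiplier legs)`.  This is what turns rule 4
of the relative inverse into rule 3 (`RelInvBorderedHessian`).
* §1 `sgnF`, **`sgnK K x y a b := sgnF a · sgnF b · K x y a b`**; `sgnK_sgnK`, `comp_sgnK` (`S(A∘B)S = SAS ∘ SBS`, termwise), `trK_sgnK`,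
  `decays_sgnK` / `Spr.sgnK`, and `sgnK_eq_self` for kernels with vanishing mixed blocks;
* §2 pairing with an indicator (`lip1_delta1_left`), summability of indicators, the MATRIX SYMMETRY OF `d*d`
  (`curvAdj_curv_delta1_symm`, Green's identity `KKTFluctuationEnergy.lip1_curvAdj`) and the MATRIX DUALITY `𝒬 ↔ 𝒬ᵀ`
  (`contourSum_delta1_eq_contourSumAdj`, `KKTFluctuationEnergy.lip1_contourSumAdj`); hence **`trK_bhK : trK (bhK N) = sgnK (bhK N)`**;
* §3 **`trK_KInv : trK (KInv N) = sgnK (KInv N)`** (`Γ = Γᵀ`: `KKTFluctuationEnergy.Gam_symm`; `ℋ♭ = −ℋᵀ`: an5's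
  `ResolventComposition.GamΦ_quo_eq_neg_wH`; the coarse–coarse block symmetric: the GAN24 swarm's `GAN24.TransverseDictionary.wΦ_symm`,
  reused BY NAME).

All declarations `[folklore]` (Green's identities for exponentially decaying / finitely supported lattice forms, by name); axioms standard.
Provenance: b2b-balaban β sub-cell, unit beta-an2 gen 13, 2026-08-20 (v1); over `BorderedHessianKernel`, `KKTFluctuationEnergy`,
`ResolventComposition`, `GAN24.TransverseDictionary`, `OneStepResolventKernel` BY NAME; no existing file touched.
-/

open Finset
open scoped BigOperators
open Literature.Probability.LatticeModels (TorusSite Torus.proj Torus.proj_apply)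
open Literature.MathematicalPhysics.QuantumFieldTheory
open Literature.MathematicalPhysics.QuantumFieldTheory.Balaban1983to89
open Literature.MathematicalPhysics.QuantumFieldTheory.Balaban1983to89.Beta
open B12Sec2to5 (l1 l1_nonneg)
open ExpKernelCalculus (MKer Decays BiLoc comp tr shiftK)
open AffineAveraging (Form0 Form1 Form2 box toSite unitVec unitVec_apply dz curv curvAdj codiff₁ contourSum)
open AffineReproduction (contourSumAdj)
open LatticeForm (quo)
open KKTFluctuationKernel (delta1 delta1_apply Gam GamΦ)
open KKTFluctuationEnergy (lip1 lip2 lip2_comm lip1_curvAdj lip1_contourSumAdj summable_curv Gam_symm summable_mul_of_bdd')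
open KernelSpecInstance (wH wΦ)
open ResolventComposition (GamΦ_quo_eq_neg_wH)
open OneStepResolventKernel (Fib KInv quo_zsmul eq_zsmul_quo_of_proj proj_zsmul)
open Summit.QuantumFields.BalabanUV.Beta.TameKernelCalculus
open Summit.QuantumFields.BalabanUV.Beta.AxialDressingRooted (cube mem_cube)

namespace Summit.QuantumFields.BalabanUV.Beta.BorderedHessian

noncomputable section

variable {d : ℕ}

/-! ## §1 The sign-conjugation gadget -/

section Sgn

/-- [folklore] The sign of a fibre leg: `+1` on field legs, `−1` on multiplier legs. -/
def sgnF : Fib d → ℝ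
  | Sum.inl _ => 1
  | Sum.inr _ => -1

/-- [folklore] `sgnF` on a field leg. -/
@[simp] theorem sgnF_inl (κ : Fin (d + 1)) : sgnF (d := d) (Sum.inl κ) = 1 := rfl

/-- [folklore] `sgnF` on a multiplier leg. -/
@[simp] theorem sgnF_inr (κ : Fin (d + 1)) : sgnF (d := d) (Sum.inr κ) = -1 := rfl

/-- [folklore] `sgnF² = 1`. -/
theorem sgnF_mul_self (a : Fib d) : sgnF a * sgnF a = 1 := by
  rcases a with κ | κ <;> simp

/-- [folklore] **SIGN CONJUGATION** of a kernel: `(S K S) x y a b = sgnF a · sgnF b · K x y a b`. -/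
def sgnK (K : MKer (d + 1) (Fib d)) : MKer (d + 1) (Fib d) := fun x y a b => sgnF a * sgnF b * K x y a b

/-- [folklore] `sgnK` pointwise. -/
theorem sgnK_apply (K : MKer (d + 1) (Fib d)) (x y : Fin (d + 1) → ℤ) (a b : Fib d) :
    sgnK K x y a b = sgnF a * sgnF b * K x y a b := rfl

/-- [folklore] `sgnK` is an involution. -/
theorem sgnK_sgnK (K : MKer (d + 1) (Fib d)) : sgnK (sgnK K) = K := by
  funext x y a b
  rw [sgnK_apply, sgnK_apply]
  have ha := sgnF_mul_self a
  have hb := sgnF_mul_self b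
  calc sgnF a * sgnF b * (sgnF a * sgnF b * K x y a b) = (sgnF a * sgnF a) * (sgnF b * sgnF b) * K x y a b := by ring
    _ = K x y a b := by rw [ha, hb, one_mul, one_mul]

/-- [folklore] `S(A∘B)S = (SAS)∘(SBS)` — termwise, no summability needed. -/
theorem comp_sgnK (A B : MKer (d + 1) (Fib d)) : comp (sgnK A) (sgnK B) = sgnK (comp A B) := by
  funext x z a b
  unfold ExpKernelCalculus.comp
  rw [sgnK_apply, ← tsum_mul_left]
  refine tsum_congr fun y => ?_
  rw [Finset.mul_sum]
  refine Finset.sum_congr rfl fun f _ => ?_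
  rw [sgnK_apply, sgnK_apply]
  have hf := sgnF_mul_self f
  calc sgnF a * sgnF f * A x y a f * (sgnF f * sgnF b * B y z f b)
      = sgnF a * sgnF b * (sgnF f * sgnF f) * (A x y a f * B y z f b) := by ring
    _ = sgnF a * sgnF b * (A x y a f * B y z f b) := by rw [hf, mul_one]

/-- [folklore] `sgnK` commutes with transposition. -/
theorem trK_sgnK (K : MKer (d + 1) (Fib d)) : trK (sgnK K) = sgnK (trK K) := by
  funext x y a b
  rw [trK_apply, sgnK_apply, sgnK_apply, trK_apply, mul_comm (sgnF b) (sgnF a)]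

/-- [folklore] `sgnK` preserves `Decays`. -/
theorem decays_sgnK {K : MKer (d + 1) (Fib d)} {C δ : ℝ} (h : Decays K C δ) : Decays (sgnK K) C δ := by
  intro x y a b
  rw [sgnK_apply, abs_mul, abs_mul]
  have ha : |sgnF a| = 1 := by rcases a with κ | κ <;> simp
  have hb : |sgnF b| = 1 := by rcases b with κ | κ <;> simp
  rw [ha, hb, one_mul, one_mul]
  exact h x y a b

/-- [folklore] `sgnK` preserves `Spr`. -/
theorem spr_sgnK {K : MKer (d + 1) (Fib d)} (h : Spr K) : Spr (sgnK K) := by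
  obtain ⟨C, δ, hδ, hK⟩ := h
  exact ⟨C, δ, hδ, decays_sgnK hK⟩

/-- [folklore] A kernel with vanishing MIXED blocks is fixed by `sgnK`. -/
theorem sgnK_eq_self {K : MKer (d + 1) (Fib d)} (h1 : ∀ x y κ l, K x y (Sum.inl κ) (Sum.inr l) = 0)
    (h2 : ∀ x y κ l, K x y (Sum.inr κ) (Sum.inl l) = 0) : sgnK K = K := by
  funext x y a b
  rw [sgnK_apply]
  rcases a with κ | κ <;> rcases b with l | l
  · simp
  · rw [h1]; ring
  · rw [h2]; ring
  · simp

end Sgn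

/-! ## §2 Matrix symmetry of `d*d`, the duality `𝒬 ↔ 𝒬ᵀ`, and `trK (bhK N)` -/

section TrBhK

/-- [folklore] An indicator 1-form is summable in the site (each component is supported at one point). -/
theorem summable_delta1 (l : Fin (d + 1)) (y : Fin (d + 1) → ℤ) (κ : Fin (d + 1)) : Summable (delta1 l y κ) := by
  refine summable_of_ne_finset_zero (s := {y}) fun z hz => ?_
  rw [Finset.mem_singleton] at hz
  rw [delta1_apply, if_neg (fun h => hz h.2)]

/-- [folklore] PAIRING WITH AN INDICATOR extracts the entry: `⟨δ_{(κ,x)}, B⟩ = B_κ(x)`. -/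
theorem lip1_delta1_left (κ : Fin (d + 1)) (x : Fin (d + 1) → ℤ) (B : Form1 (d + 1) ℝ) : lip1 (delta1 κ x) B = B κ x := by
  unfold KKTFluctuationEnergy.lip1
  have e : ∀ z, ∑ μ, delta1 κ x μ z * B μ z = if z = x then B κ x else 0 := by
    intro z
    by_cases hz : z = x
    · subst hz
      rw [if_pos rfl, Finset.sum_eq_single κ]
      · simp
      · intro μ _ hμ; rw [delta1_apply, if_neg (fun h => hμ h.1), zero_mul]
      · intro h; exact absurd (Finset.mem_univ κ) h
    · rw [if_neg hz]
      refine Finset.sum_eq_zero fun μ _ => ?_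
      rw [delta1_apply, if_neg (fun h => hz h.2), zero_mul]
  rw [tsum_congr e, tsum_eq_single x (fun z hz => if_neg hz), if_pos rfl]

/-- [folklore] **MATRIX SYMMETRY OF `d*d`**: `(d*d δ_{(l,y)})_κ(x) = (d*d δ_{(κ,x)})_l(y)` (Green's identity twice: both are
`⟨curv δ_{(κ,x)}, curv δ_{(l,y)}⟩`). -/
theorem curvAdj_curv_delta1_symm (κ l : Fin (d + 1)) (x y : Fin (d + 1) → ℤ) :
    curvAdj (curv (delta1 l y)) κ x = curvAdj (curv (delta1 κ x)) l y := by
  have h1 : lip1 (delta1 κ x) (curvAdj (curv (delta1 l y))) = lip2 (curv (delta1 κ x)) (curv (delta1 l y)) :=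
    lip1_curvAdj (abs_delta1_le κ x) (fun a b => summable_curv (summable_delta1 l y) a b)
  have h2 : lip1 (delta1 l y) (curvAdj (curv (delta1 κ x))) = lip2 (curv (delta1 l y)) (curv (delta1 κ x)) :=
    lip1_curvAdj (abs_delta1_le l y) (fun a b => summable_curv (summable_delta1 κ x) a b)
  rw [← lip1_delta1_left κ x (curvAdj (curv (delta1 l y))), ← lip1_delta1_left l y (curvAdj (curv (delta1 κ x))), h1, h2,
    lip2_comm]

/-- [folklore] **MATRIX DUALITY `𝒬 ↔ 𝒬ᵀ`**: `(𝒬_N δ_{(κ,x)})_l(y′) = (𝒬ᵀ_N δ_{(l,y′)})_κ(x)` (`lip1_contourSumAdj` on indicators). -/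
theorem contourSum_delta1_eq_contourSumAdj (N : ℕ) [NeZero N] (κ l : Fin (d + 1)) (x y' : Fin (d + 1) → ℤ) :
    contourSum N (delta1 κ x) l y' = contourSumAdj N (delta1 l y') κ x := by
  have h := lip1_contourSumAdj (N := N) (A := delta1 κ x) (φ := delta1 l y') (fun μ => summable_delta1 κ x μ)
    (abs_delta1_le l y')
  rw [lip1_delta1_left] at h
  rw [h]
  have e : ∀ y, ∑ μ, delta1 l y' μ y * contourSum N (delta1 κ x) μ y = if y = y' then contourSum N (delta1 κ x) l y' else 0 := by
    intro y
    by_cases hy : y = y'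
    · subst hy
      rw [if_pos rfl, Finset.sum_eq_single l]
      · simp
      · intro μ _ hμ; rw [delta1_apply, if_neg (fun h => hμ h.1), zero_mul]
      · intro h'; exact absurd (Finset.mem_univ l) h'
    · rw [if_neg hy]
      refine Finset.sum_eq_zero fun μ _ => ?_
      rw [delta1_apply, if_neg (fun h => hy h.2), zero_mul]
  rw [tsum_congr e, tsum_eq_single y' (fun y hy => if_neg hy), if_pos rfl]

/-- [folklore] The window is symmetric: `y − x ∈ cube ↔ x − y ∈ cube`. -/
theorem sub_mem_cube_comm {n M : ℕ} (x y : Fin n → ℤ) : y - x ∈ cube n M ↔ x - y ∈ cube n M := by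
  rw [mem_cube, mem_cube]
  constructor <;> intro h i <;> have := h i <;> rw [Pi.sub_apply] at this ⊢ <;> rw [abs_sub_comm] <;> exact this

/-- [folklore] **`trK (bhK N) = sgnK (bhK N)`**: the bordered Hessian is sign-conjugate symmetric (`d*d` symmetric, `𝒬 ↔ 𝒬ᵀ` dual,
off-diagonal signs `∓`). -/
theorem trK_bhK (N : ℕ) [NeZero N] : trK (bhK (d := d) N) = sgnK (bhK N) := by
  funext x y a b
  rw [trK_apply, sgnK_apply]
  rcases a with κ | κ <;> rcases b with l | l
  · rw [sgnF_inl, sgnF_inl, one_mul, one_mul, bhK_inl_inl, bhK_inl_inl]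
    by_cases h : y - x ∈ cube (d + 1) 2
    · rw [if_pos h, if_pos ((sub_mem_cube_comm x y).1 h), curvAdj_curv_delta1_symm]
    · rw [if_neg h, if_neg (fun h' => h ((sub_mem_cube_comm x y).2 h'))]
  · rw [sgnF_inl, sgnF_inr, bhK_inr_inl, bhK_inl_inr]
    split_ifs with hy
    · rw [contourSum_delta1_eq_contourSumAdj]; ring
    · ring
  · rw [sgnF_inr, sgnF_inl, bhK_inl_inr, bhK_inr_inl]
    split_ifs with hx
    · rw [← contourSum_delta1_eq_contourSumAdj]; ring
    · ring
  · rw [bhK_inr_inr, bhK_inr_inr]; ring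

end TrBhK

/-! ## §3 `trK (KInv N) = sgnK (KInv N)` -/

section TrKInv

variable (N : ℕ) [NeZero N]

/-- [folklore] **THE PACKED RESOLVENT IS SIGN-CONJUGATE SYMMETRIC**: `trK (KInv N) = sgnK (KInv N)` (`Γ = Γᵀ`: `Gam_symm`;
`ℋ♭ = −ℋᵀ`: `GamΦ_quo_eq_neg_wH`; `−𝒞` symmetric: `wΦ_symm`). -/
theorem trK_KInv : trK (KInv (N := N) (d := d)) = sgnK (KInv (N := N)) := by
  funext x y a b
  rw [trK_apply, sgnK_apply]
  rcases a with κ | κ <;> rcases b with l | l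
  · rw [sgnF_inl, sgnF_inl, one_mul, one_mul]
    show Gam (N := N) l y κ x = Gam (N := N) κ x l y
    exact Gam_symm (N := N) l κ y x
  · rw [sgnF_inl, sgnF_inr]
    show (if Torus.proj N y = 0 then GamΦ (N := N) l (quo N y) κ x else 0) =
      1 * -1 * (if Torus.proj N y = 0 then wH (N := N) κ l (x - y) else 0)
    split_ifs with hy
    · rw [GamΦ_quo_eq_neg_wH hy]; ring
    · ring
  · rw [sgnF_inr, sgnF_inl]
    show (if Torus.proj N x = 0 then wH (N := N) l κ (y - x) else 0) =
      -1 * 1 * (if Torus.proj N x = 0 then GamΦ (N := N) κ (quo N x) l y else 0)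
    split_ifs with hx
    · rw [GamΦ_quo_eq_neg_wH hx]; ring
    · ring
  · rw [sgnF_inr, sgnF_inr]
    show (if Torus.proj N y = 0 ∧ Torus.proj N x = 0 then wΦ (N := N) l κ (quo N y - quo N x) else 0) =
      -1 * -1 * (if Torus.proj N x = 0 ∧ Torus.proj N y = 0 then wΦ (N := N) κ l (quo N x - quo N y) else 0)
    by_cases h : Torus.proj N x = 0 ∧ Torus.proj N y = 0
    · rw [if_pos ⟨h.2, h.1⟩, if_pos h, GAN24.TransverseDictionary.wΦ_symm κ l, neg_sub]; ring
    · rw [if_neg (fun h' => h ⟨h'.2, h'.1⟩), if_neg h]; ring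

end TrKInv

end

end Summit.QuantumFields.BalabanUV.Beta.BorderedHessian
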